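import Literature.Analysis.FluidPDE.NovackKernelFamily
import Literature.Analysis.FluidPDE.EyinkBalance
import HarnessLib

/-!
# Eyink's longitudinal and transverse kernels `(ℓ̂⊗ℓ̂)φ`, `(1 − ℓ̂⊗ℓ̂)φ` as smooth matrix kernels

Topic: Analysis/FluidPDE. Support file for the discharge of the named facts
`Torus.eyink_longitudinal_balance`, `Torus.eyink_transverse_balance`
(`Literature.Analysis.FluidPDE.EyinkBalance`; G. L. Eyink, *Local 4/5-law and energy dissipation
anomaly in turbulence*, Nonlinearity 16 (2003) 137–145, §2, (uuL-eq)/(uuT-eq)). Eyink derives the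
two balances by running the Duchon–Robert computation for the **matrix-valued** kernels
`(ℓ̂⊗ℓ̂)φ^ε(ℓ)` (longitudinal) and `(1 − ℓ̂⊗ℓ̂)φ^ε(ℓ)` (transverse) in place of the scalar `φ^ε`
((u-LT)–(Pi-LT), (id-L)/(id-T)); the tree records that computation for a general **smooth**, even,
symmetric matrix kernel `M` with a smooth pressure potential `ζ` (`∑ᵢ∂ᵢMᵢⱼ = ∂ⱼζ`) in
`Literature.Analysis.FluidPDE.NovackMatrixKernel` (named facts `Torus.integral_matKernelFlux_mul_eq`,
`Torus.IsDistributionalNSSolutionOn.matSymmTestField_identity`; proved pressure step). Eyink's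
kernels are smooth only away from the origin ("`φ_L, φ_T` are … `C^∞` everywhere except at `0`,
where they have a mild (logarithmic) singularity"), so the matrix facts are applied to them after
excising a small ball (a profile `φ` vanishing near `0`), the excision being removed in the limit in
`EyinkBalanceProofs`. This file supplies the kernel-level algebra and calculus of that reduction.

## Contents (all proved; the definitions are auxiliary)

* `Torus.radMatKernelE A B i j y = A(|y|²)δᵢⱼ + B(|y|²)yᵢyⱼ` — the general smooth radial matrix
  kernel; evenness, symmetry, smoothness, support, its derivative
  (`fderiv_radMatKernelE_apply_single`), **the divergence identity**
  `∑ᵢ∂ᵢ mᵢⱼ = ∂ⱼ Z(|y|²)` whenever `Z' = A' + sB' + ((d+1)/2)B` (`sum_fderiv_radMatKernelE`), and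
  **the cubic contraction** `∑ᵢⱼₗ ∂ₗmᵢⱼ(y) aᵢaⱼaₗ = ⟪a,y⟫[2A'|a|² + 2B'⟪a,y⟫² + 2B|a|²]`
  (`sum_fderiv_radMatKernelE_mul_mul_mul`).
* `Torus.sqProfile k e s = k(√s e)` — the profile of a radial kernel as a function of `s = |y|²`;
  it is smooth when `k` is smooth and vanishes near the origin (`contDiff_sqProfile`; no Whitney-type
  theorem is needed thanks to the excision), and `k(y) = G(|y|²)`.
* `Torus.transPotentialProfile d G s = ((d−1)/2)∫_s^∞ G(τ)dτ/τ`, `Torus.longPotentialProfile = G − Z_T`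
  — Eyink's `φ_T`, `φ_L` ((phi-LT)) as profiles: primitives (`hasDerivAt_transPotentialProfile`),
  smooth, compactly supported, and satisfying the divergence hypothesis for
  `(A,B) = (G, −G/s)` resp. `(0, G/s)` (`hasDerivAt_transPotentialProfile_eq`, `…long…`).
* `Torus.eyinkMatKernelTE G = radMatKernelE G (−G/s)`, `Torus.eyinkMatKernelLE G = radMatKernelE 0 (G/s)`:
  `m_T^{ij}(y) = k(y)(δᵢⱼ − ŷᵢŷⱼ)`, `m_L^{ij}(y) = k(y)ŷᵢŷⱼ` (`…_apply`), their contractions with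
  vectors (`sum_eyinkMatKernelTE_mul`: `k(1 − ŷ⊗ŷ)w`; `sum_sum_…_mul_mul`: `k(|w|² − ⟪ŷ,w⟫²)`),
  **`∇·m_T = ∇(Z_T∘|·|²)`, `∇·m_L = ∇(Z_L∘|·|²)`** (`sum_fderiv_eyinkMatKernelTE/LE`), and
  **Eyink's (id-T)/(id-L), first equalities**: the cubic contractions of `∇m_T`, `∇m_L` with an
  increment `δ = δw(x;ξ)` are exactly the integrands `Torus.eyinkTransverseIntegrand`,
  `Torus.eyinkLongitudinalIntegrand` of `EyinkLocalFourFifths`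
  (`eyinkTransverseIntegrand_eq_sum_fderiv`, `eyinkLongitudinalIntegrand_eq_sum_fderiv`).
* `Torus.eyinkTransverseKernel_eq_transPotentialProfile`: **`φ_T(ξ) = Z_T(|ξ|²)` for `ξ ≠ 0`**, where
  `φ_T = Torus.eyinkTransverseKernel d k` is the kernel of Eyink's pressure object in `EyinkBalance`
  (the substitution `τ = s²|ξ|²`); likewise `φ_L`.
* Torus side: `Torus.eyinkMatKernelT/L G i j = periodize (m_T/L^{ij})`,
  `Torus.eyinkPotentialT/L d G = periodize (Z_{T/L}∘|·|²)` are smooth, even, symmetric, and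
  **`∑ᵢ ∂ᵢ M^{ij} = ∂ⱼ ζ` on `T^d`** (`sum_partialDeriv_eyinkMatKernelT/L`) — precisely the hypotheses
  of the matrix facts and of `Torus.integral_pressure_divergence_matSymmTestField`;
  `partialDeriv_periodize` (`∂ₗ∘periodize = periodize∘∂ₗ`).
* `Torus.IsRadialBump φ` (smooth, compactly supported, spherically symmetric; no sign or mass
  condition, so stable under excision and differences), rescaling, and
  `sqProfile_mollifierScale_facts` (the profile of `φ^ε` for `φ` vanishing near `0`).

## References

* G. L. Eyink, Nonlinearity 16 (2003) 137–145 = arXiv:nlin/0208004, §2: (u-LT)–(moll-u-LT),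
  (Pi-LT)–(p-LT), (phi-LT), (grad-Pi-L)–(grad-phi-L), (id-L), (id-T). [Eyink2003]
* M. Novack, Nonlinearity 37 (2024) 095002, §2 Step 2 (matrix kernels `T^{ij}φ` with potentials
  `ζ̃`: the smooth-kernel form of the same computation). [Novack2024]
-/

noncomputable section

open MeasureTheory TopologicalSpace Set Function Filter Metric
open _root_.Topology
open scoped ENNReal NNReal Convolution ContDiff InnerProductSpace RealInnerProductSpace

namespace Literature.Analysis.FluidPDE.Torus

variable {d : Type*} [Fintype d] [DecidableEq d]

/-! ## Radial matrix kernels `A(|y|²) 1 + B(|y|²) y ⊗ y` on `ℝ^d` -/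

section Euclidean

/-- The **radial matrix kernel with profiles `A`, `B`** on `ℝ^d`, entry `(i, j)`:
`m^{ij}(y) = A(|y|²) δᵢⱼ + B(|y|²) yᵢ yⱼ` — the general form of a smooth kernel built from the
identity and `y ⊗ y` with radial coefficients; Eyink's kernels `(ℓ̂⊗ℓ̂)φ(ℓ)` and `(1 − ℓ̂⊗ℓ̂)φ(ℓ)`
(Eyink 2003, §2, (u-LT)–(Pi-LT)) are the cases `A = 0, B = G(s)/s` and `A = G, B = −G(s)/s`,
`φ(y) = G(|y|²)` (away from the origin). [cite: Eyink2003, §2 (u-LT)–(Pi-LT)] -/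
def radMatKernelE (A B : ℝ → ℝ) (i j : d) (y : EuclideanSpace ℝ d) : ℝ :=
  A (‖y‖ ^ 2) * (if i = j then 1 else 0) + B (‖y‖ ^ 2) * (y i * y j)

variable {A B : ℝ → ℝ}

/-- Unfolding `radMatKernelE`. [folklore] -/
theorem radMatKernelE_apply (A B : ℝ → ℝ) (i j : d) (y : EuclideanSpace ℝ d) :
    radMatKernelE A B i j y = A (‖y‖ ^ 2) * (if i = j then 1 else 0) + B (‖y‖ ^ 2) * (y i * y j) :=
  rfl

/-- The radial matrix kernel is even: `m^{ij}(−y) = m^{ij}(y)`. [folklore] -/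
theorem radMatKernelE_neg (A B : ℝ → ℝ) (i j : d) (y : EuclideanSpace ℝ d) :
    radMatKernelE A B i j (-y) = radMatKernelE A B i j y := by
  simp [radMatKernelE, norm_neg]

/-- The radial matrix kernel is symmetric: `m^{ij} = m^{ji}`. [folklore] -/
theorem radMatKernelE_comm (A B : ℝ → ℝ) (i j : d) : radMatKernelE A B i j = radMatKernelE A B j i := by
  funext y
  simp only [radMatKernelE, mul_comm (y i) (y j)]
  by_cases h : i = j
  · subst h; rfl
  · simp [h, Ne.symm h]

/-- The radial matrix kernel is smooth for smooth profiles. [folklore] -/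
theorem contDiff_radMatKernelE (hA : ContDiff ℝ ∞ A) (hB : ContDiff ℝ ∞ B) (i j : d) :
    ContDiff ℝ ∞ (radMatKernelE A B i j) := by
  unfold radMatKernelE
  refine ((contDiff_comp_norm_sq hA).mul contDiff_const).add ((contDiff_comp_norm_sq hB).mul ?_)
  exact ((EuclideanSpace.proj (𝕜 := ℝ) i).contDiff).mul ((EuclideanSpace.proj (𝕜 := ℝ) j).contDiff)

/-- If both profiles vanish on `[R², ∞)` then the kernel vanishes for `‖y‖ ≥ R` (`R ≥ 0`). [folklore] -/
theorem radMatKernelE_eq_zero {R : ℝ} (hR : 0 ≤ R) (hA : ∀ s, R ^ 2 ≤ s → A s = 0)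
    (hB : ∀ s, R ^ 2 ≤ s → B s = 0) (i j : d) {y : EuclideanSpace ℝ d} (hy : R ≤ ‖y‖) :
    radMatKernelE A B i j y = 0 := by
  have h2 : R ^ 2 ≤ ‖y‖ ^ 2 := pow_le_pow_left₀ hR hy 2
  simp [radMatKernelE, hA _ h2, hB _ h2]

/-- Support of the kernel in the closed ball of radius `R`. [folklore] -/
theorem tsupport_radMatKernelE_subset {R : ℝ} (hR : 0 ≤ R) (hA : ∀ s, R ^ 2 ≤ s → A s = 0)
    (hB : ∀ s, R ^ 2 ≤ s → B s = 0) (i j : d) :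
    tsupport (radMatKernelE A B i j) ⊆ closedBall (0 : EuclideanSpace ℝ d) R :=
  tsupport_subset_closedBall_of_eq_zero fun _ hy => radMatKernelE_eq_zero hR hA hB i j hy

/-- The Fréchet derivative of an entry of the radial matrix kernel on a basis vector:
`∂ₖ m^{ij}(y) = 2A'(|y|²) yₖ δᵢⱼ + B(|y|²)(δᵢₖ yⱼ + yᵢ δⱼₖ) + 2B'(|y|²) yₖ yᵢ yⱼ`. [folklore] -/
theorem fderiv_radMatKernelE_apply_single (hA : ContDiff ℝ ∞ A) (hB : ContDiff ℝ ∞ B) (i j k : d)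
    (y : EuclideanSpace ℝ d) :
    fderiv ℝ (radMatKernelE A B i j) y (EuclideanSpace.single k 1) =
      (if i = j then 1 else 0) * (2 * deriv A (‖y‖ ^ 2) * y k) +
        (B (‖y‖ ^ 2) * ((if i = k then 1 else 0) * y j + y i * (if j = k then 1 else 0)) +
          y i * y j * (2 * deriv B (‖y‖ ^ 2) * y k)) := by
  have hN : HasFDerivAt (fun x : EuclideanSpace ℝ d => ‖x‖ ^ 2) (2 • innerSL ℝ y) y :=
    (hasStrictFDerivAt_norm_sq y).hasFDerivAt
  have hAd : HasDerivAt A (deriv A (‖y‖ ^ 2)) (‖y‖ ^ 2) :=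
    ((hA.differentiable (by simp)) _).hasDerivAt
  have hBd : HasDerivAt B (deriv B (‖y‖ ^ 2)) (‖y‖ ^ 2) :=
    ((hB.differentiable (by simp)) _).hasDerivAt
  have hAN : HasFDerivAt (fun x : EuclideanSpace ℝ d => A (‖x‖ ^ 2))
      ((deriv A (‖y‖ ^ 2)) • (2 • innerSL ℝ y)) y :=
    HasDerivAt.comp_hasFDerivAt (h₂ := A) (f := fun x : EuclideanSpace ℝ d => ‖x‖ ^ 2) y hAd hN
  have hBN : HasFDerivAt (fun x : EuclideanSpace ℝ d => B (‖x‖ ^ 2))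
      ((deriv B (‖y‖ ^ 2)) • (2 • innerSL ℝ y)) y :=
    HasDerivAt.comp_hasFDerivAt (h₂ := B) (f := fun x : EuclideanSpace ℝ d => ‖x‖ ^ 2) y hBd hN
  have hπ : ∀ m : d, HasFDerivAt (fun x : EuclideanSpace ℝ d => x m)
      (EuclideanSpace.proj m : EuclideanSpace ℝ d →L[ℝ] ℝ) y := fun m =>
    (EuclideanSpace.proj (𝕜 := ℝ) m).hasFDerivAt
  have hπij : HasFDerivAt (fun x : EuclideanSpace ℝ d => x i * x j)
      (y i • (EuclideanSpace.proj j : EuclideanSpace ℝ d →L[ℝ] ℝ) +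
        y j • (EuclideanSpace.proj i : EuclideanSpace ℝ d →L[ℝ] ℝ)) y := (hπ i).mul (hπ j)
  have h1 : HasFDerivAt (fun x : EuclideanSpace ℝ d => A (‖x‖ ^ 2) * (if i = j then (1 : ℝ) else 0))
      ((if i = j then (1 : ℝ) else 0) • ((deriv A (‖y‖ ^ 2)) • (2 • innerSL ℝ y))) y :=
    hAN.mul_const _
  have h2 : HasFDerivAt (fun x : EuclideanSpace ℝ d => B (‖x‖ ^ 2) * (x i * x j))
      (B (‖y‖ ^ 2) • (y i • (EuclideanSpace.proj j : EuclideanSpace ℝ d →L[ℝ] ℝ) +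
          y j • (EuclideanSpace.proj i : EuclideanSpace ℝ d →L[ℝ] ℝ)) +
        (y i * y j) • ((deriv B (‖y‖ ^ 2)) • (2 • innerSL ℝ y))) y :=
    hBN.mul hπij
  have h : HasFDerivAt (radMatKernelE A B i j)
      (((if i = j then (1 : ℝ) else 0) • ((deriv A (‖y‖ ^ 2)) • (2 • innerSL ℝ y))) +
        (B (‖y‖ ^ 2) • (y i • (EuclideanSpace.proj j : EuclideanSpace ℝ d →L[ℝ] ℝ) +
          y j • (EuclideanSpace.proj i : EuclideanSpace ℝ d →L[ℝ] ℝ)) +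
        (y i * y j) • ((deriv B (‖y‖ ^ 2)) • (2 • innerSL ℝ y)))) y := h1.add h2
  rw [h.fderiv]
  simp only [smul_apply, add_apply,
    innerSL_apply_apply, EuclideanSpace.inner_single_right, PiLp.proj_apply, PiLp.single_apply,
    smul_eq_mul, conj_trivial, one_mul]
  by_cases hik : i = k
  · by_cases hjk : j = k
    · simp only [if_pos hik, if_pos hjk]; ring
    · simp only [if_pos hik, if_neg hjk]; ring
  · by_cases hjk : j = k
    · simp only [if_neg hik, if_pos hjk]; ring
    · simp only [if_neg hik, if_neg hjk]; ring

/-- The Fréchet derivative of a radial scalar `y ↦ Z(|y|²)` on a basis vector: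
`∂ⱼ Z(|y|²) = 2 Z'(|y|²) yⱼ`. [folklore] -/
theorem fderiv_comp_norm_sq_apply_single {Z : ℝ → ℝ} {z : ℝ} (y : EuclideanSpace ℝ d)
    (hZ : HasDerivAt Z z (‖y‖ ^ 2)) (j : d) :
    fderiv ℝ (fun x : EuclideanSpace ℝ d => Z (‖x‖ ^ 2)) y (EuclideanSpace.single j 1) = 2 * z * y j := by
  have hN : HasFDerivAt (fun x : EuclideanSpace ℝ d => ‖x‖ ^ 2) (2 • innerSL ℝ y) y :=
    (hasStrictFDerivAt_norm_sq y).hasFDerivAt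
  have h : HasFDerivAt (fun x : EuclideanSpace ℝ d => Z (‖x‖ ^ 2)) (z • (2 • innerSL ℝ y)) y :=
    HasDerivAt.comp_hasFDerivAt (h₂ := Z) (f := fun x : EuclideanSpace ℝ d => ‖x‖ ^ 2) y hZ hN
  rw [h.fderiv]
  simp only [smul_apply, innerSL_apply_apply,
    EuclideanSpace.inner_single_right, smul_eq_mul, conj_trivial]
  ring

/-- **The divergence of a radial matrix kernel is a gradient**: if
`Z' = A' + s B' + ((d+1)/2) B`, then `∑ᵢ ∂ᵢ m^{ij}(y) = ∂ⱼ Z(|y|²)` on `ℝ^d`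
(`∑ᵢ ∂ᵢ[Aδᵢⱼ + B yᵢyⱼ] = yⱼ[2A' + 2|y|²B' + (d+1)B]`; Eyink 2003, §2, (grad-Pi-L)–(grad-phi-L):
`∇·[(ℓ̂⊗ℓ̂)φ] = ∇φ_L`, `∇·Π_T = ∇p_T`). [cite: Eyink2003, §2 (grad-Pi-L)–(grad-phi-L)] -/
theorem sum_fderiv_radMatKernelE (hA : ContDiff ℝ ∞ A) (hB : ContDiff ℝ ∞ B) {Z : ℝ → ℝ}
    (hZ : ∀ s, HasDerivAt Z (deriv A s + s * deriv B s + (((Fintype.card d : ℝ) + 1) / 2) * B s) s)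
    (j : d) (y : EuclideanSpace ℝ d) :
    ∑ i, fderiv ℝ (radMatKernelE A B i j) y (EuclideanSpace.single i 1) =
      fderiv ℝ (fun x : EuclideanSpace ℝ d => Z (‖x‖ ^ 2)) y (EuclideanSpace.single j 1) := by
  have hsq : ∑ i, y i * y i = ‖y‖ ^ 2 := by
    rw [EuclideanSpace.real_norm_sq_eq]
    exact Finset.sum_congr rfl fun i _ => by ring
  set a1 := deriv A (‖y‖ ^ 2) with ha1
  set b0 := B (‖y‖ ^ 2) with hb0
  set b1 := deriv B (‖y‖ ^ 2) with hb1
  have key : ∀ i, fderiv ℝ (radMatKernelE A B i j) y (EuclideanSpace.single i 1) =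
      2 * a1 * (if i = j then y i else 0) + b0 * y j + b0 * (if j = i then y i else 0) +
        2 * b1 * y j * (y i * y i) := by
    intro i
    rw [fderiv_radMatKernelE_apply_single hA hB]
    by_cases hij : i = j
    · subst hij
      simp only [if_true]
      ring
    · have hji : ¬ j = i := fun h => hij h.symm
      simp only [hij, hji, if_false, if_true]
      ring
  have e1 : ∑ i, 2 * a1 * (if i = j then y i else 0) = 2 * a1 * y j := by
    rw [← Finset.mul_sum, Finset.sum_ite_eq']
    simp
  have e2 : ∑ _i : d, b0 * y j = (Fintype.card d : ℝ) * (b0 * y j) := by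
    rw [Finset.sum_const, Finset.card_univ, nsmul_eq_mul]
  have e3 : ∑ i, b0 * (if j = i then y i else 0) = b0 * y j := by
    rw [← Finset.mul_sum, Finset.sum_ite_eq]
    simp
  have e4 : ∑ i, 2 * b1 * y j * (y i * y i) = 2 * b1 * y j * ‖y‖ ^ 2 := by
    rw [← Finset.mul_sum, hsq]
  rw [Finset.sum_congr rfl fun i _ => key i, Finset.sum_add_distrib, Finset.sum_add_distrib,
    Finset.sum_add_distrib, e1, e2, e3, e4, fderiv_comp_norm_sq_apply_single y (hZ _) j]
  ring

omit [DecidableEq d] in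
/-- `⟪a, v⟫ = ∑ᵢ aᵢ vᵢ` on `ℝ^d`. [folklore] -/
private theorem real_inner_eq_sum_mul' (a v : EuclideanSpace ℝ d) : ⟪a, v⟫ = ∑ i, a i * v i := by
  rw [PiLp.inner_apply]
  refine Finset.sum_congr rfl fun i _ => ?_
  simp [mul_comm]

/-- **The cubic contraction of the kernel gradient**: for every vector `a`,
`∑ᵢⱼₖ ∂ₖ m^{ij}(y) aᵢ aⱼ aₖ = ⟪a,y⟫ [2A'(|y|²)|a|² + 2B'(|y|²)⟪a,y⟫² + 2B(|y|²)|a|²]`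
(the pointwise form of Eyink 2003, (id-L)/(id-T), first equalities). [cite: Eyink2003, §2 (id-L)–(id-T)] -/
theorem sum_fderiv_radMatKernelE_mul_mul_mul (hA : ContDiff ℝ ∞ A) (hB : ContDiff ℝ ∞ B)
    (a y : EuclideanSpace ℝ d) :
    ∑ i, ∑ j, ∑ k, fderiv ℝ (radMatKernelE A B i j) y (EuclideanSpace.single k 1) * (a i * a j * a k) =
      ⟪a, y⟫ * (2 * deriv A (‖y‖ ^ 2) * ‖a‖ ^ 2 + 2 * deriv B (‖y‖ ^ 2) * ⟪a, y⟫ ^ 2 +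
        2 * B (‖y‖ ^ 2) * ‖a‖ ^ 2) := by
  set a1 := deriv A (‖y‖ ^ 2) with ha1
  set b0 := B (‖y‖ ^ 2) with hb0
  set b1 := deriv B (‖y‖ ^ 2) with hb1
  have hS : ⟪a, y⟫ = ∑ i, a i * y i := real_inner_eq_sum_mul' a y
  have hN : ‖a‖ ^ 2 = ∑ i, a i * a i := by
    rw [← real_inner_self_eq_norm_sq, real_inner_eq_sum_mul']
  -- expand each summand into four separable pieces
  have key : ∀ i j k, fderiv ℝ (radMatKernelE A B i j) y (EuclideanSpace.single k 1) * (a i * a j * a k) =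
      (if i = j then 2 * a1 * ((a i * a j) * (a k * y k)) else 0) +
        (if i = k then b0 * ((a i * a k) * (a j * y j)) else 0) +
        (if j = k then b0 * ((a j * a k) * (a i * y i)) else 0) +
        2 * b1 * ((a i * y i) * (a j * y j) * (a k * y k)) := by
    intro i j k
    rw [fderiv_radMatKernelE_apply_single hA hB]
    by_cases hij : i = j <;> by_cases hik : i = k <;> by_cases hjk : j = k
    · simp only [if_pos hij, if_pos hik, if_pos hjk]; ring
    · simp only [if_pos hij, if_pos hik, if_neg hjk]; ring
    · simp only [if_pos hij, if_neg hik, if_pos hjk]; ring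
    · simp only [if_pos hij, if_neg hik, if_neg hjk]; ring
    · simp only [if_neg hij, if_pos hik, if_pos hjk]; ring
    · simp only [if_neg hij, if_pos hik, if_neg hjk]; ring
    · simp only [if_neg hij, if_neg hik, if_pos hjk]; ring
    · simp only [if_neg hij, if_neg hik, if_neg hjk]; ring
  simp_rw [key, Finset.sum_add_distrib]
  -- piece 1: `∑ᵢⱼₖ δᵢⱼ 2a1 (aᵢaⱼ)(aₖyₖ) = 2a1 |a|² ⟪a,y⟫`
  have p1 : ∑ i, ∑ j, ∑ k, (if i = j then 2 * a1 * ((a i * a j) * (a k * y k)) else 0) =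
      2 * a1 * (‖a‖ ^ 2 * ⟪a, y⟫) := by
    have : ∀ i, ∑ j, ∑ k, (if i = j then 2 * a1 * ((a i * a j) * (a k * y k)) else 0) =
        ∑ k, 2 * a1 * ((a i * a i) * (a k * y k)) := fun i => by
      rw [Finset.sum_comm]
      refine Finset.sum_congr rfl fun k _ => ?_
      rw [Finset.sum_ite_eq]
      simp
    simp_rw [this]
    rw [hN, hS, Finset.sum_mul_sum, Finset.mul_sum]
    refine Finset.sum_congr rfl fun i _ => ?_
    rw [Finset.mul_sum]
  -- piece 2: `∑ᵢⱼₖ δᵢₖ b0 (aᵢaₖ)(aⱼyⱼ) = b0 |a|² ⟪a,y⟫`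
  have p2 : ∑ i, ∑ j, ∑ k, (if i = k then b0 * ((a i * a k) * (a j * y j)) else 0) =
      b0 * (‖a‖ ^ 2 * ⟪a, y⟫) := by
    have : ∀ i j, ∑ k, (if i = k then b0 * ((a i * a k) * (a j * y j)) else 0) =
        b0 * ((a i * a i) * (a j * y j)) := fun i j => by
      rw [Finset.sum_ite_eq Finset.univ i]
      simp
    simp_rw [this]
    rw [hN, hS, Finset.sum_mul_sum, Finset.mul_sum]
    refine Finset.sum_congr rfl fun i _ => ?_
    rw [Finset.mul_sum]
  -- piece 3: `∑ᵢⱼₖ δⱼₖ b0 (aⱼaₖ)(aᵢyᵢ) = b0 |a|² ⟪a,y⟫`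
  have p3 : ∑ i, ∑ j, ∑ k, (if j = k then b0 * ((a j * a k) * (a i * y i)) else 0) =
      b0 * (‖a‖ ^ 2 * ⟪a, y⟫) := by
    have : ∀ i j, ∑ k, (if j = k then b0 * ((a j * a k) * (a i * y i)) else 0) =
        b0 * ((a j * a j) * (a i * y i)) := fun i j => by
      rw [Finset.sum_ite_eq Finset.univ j]
      simp
    simp_rw [this]
    rw [Finset.sum_comm, hN, hS, Finset.sum_mul_sum, Finset.mul_sum]
    refine Finset.sum_congr rfl fun j _ => ?_
    rw [Finset.mul_sum]
  -- piece 4: `∑ᵢⱼₖ 2b1 (aᵢyᵢ)(aⱼyⱼ)(aₖyₖ) = 2b1 ⟪a,y⟫³`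
  have p4 : ∑ i, ∑ j, ∑ k, 2 * b1 * ((a i * y i) * (a j * y j) * (a k * y k)) = 2 * b1 * ⟪a, y⟫ ^ 3 := by
    have e3 : (∑ i, a i * y i) ^ 3 = ∑ i, ∑ j, ∑ k, (a i * y i) * (a j * y j) * (a k * y k) := by
      rw [pow_three, Finset.sum_mul_sum, Finset.sum_mul_sum]
      refine Finset.sum_congr rfl fun i _ => Finset.sum_congr rfl fun j _ => ?_
      rw [Finset.mul_sum]
      exact Finset.sum_congr rfl fun k _ => by ring
    rw [hS, e3]
    simp only [Finset.mul_sum]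
  rw [p1, p2, p3, p4]
  ring

end Euclidean

/-! ## Radial profiles as functions of `s = |y|²` -/

section Profile

variable {k : EuclideanSpace ℝ d → ℝ} {e : EuclideanSpace ℝ d} {r₀ R : ℝ}

omit [DecidableEq d] in
/-- The **square profile** `G(s) = k(√s e)` of a kernel `k` on `ℝ^d` along a unit vector `e`: for a
spherically symmetric `k`, `k(y) = G(|y|²)` (`sqProfile_norm_sq`), and `G` is smooth as soon as `k`
is smooth and vanishes near the origin (`contDiff_sqProfile`). Junk: `√s = 0` for `s ≤ 0`. [folklore] -/
def sqProfile (k : EuclideanSpace ℝ d → ℝ) (e : EuclideanSpace ℝ d) (s : ℝ) : ℝ :=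
  k (Real.sqrt s • e)

omit [DecidableEq d] in
/-- `‖√s • e‖ = √s` for a unit vector `e`. [folklore] -/
theorem norm_sqrt_smul (he : ‖e‖ = 1) (s : ℝ) : ‖Real.sqrt s • e‖ = Real.sqrt s := by
  rw [norm_smul, Real.norm_eq_abs, abs_of_nonneg (Real.sqrt_nonneg _), he, mul_one]

omit [DecidableEq d] in
/-- `G(|y|²) = k(y)` for a spherically symmetric kernel. [folklore] -/
theorem sqProfile_norm_sq (hrad : ∀ ξ η : EuclideanSpace ℝ d, ‖ξ‖ = ‖η‖ → k ξ = k η) (he : ‖e‖ = 1)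
    (y : EuclideanSpace ℝ d) : sqProfile k e (‖y‖ ^ 2) = k y := by
  unfold sqProfile
  apply hrad
  rw [norm_sqrt_smul he, Real.sqrt_sq (norm_nonneg _)]

omit [DecidableEq d] in
/-- The square profile vanishes on `(−∞, r₀²)` if `k` vanishes on the open ball of radius `r₀ > 0`. [folklore] -/
theorem sqProfile_eq_zero_of_lt (h0 : ∀ ξ : EuclideanSpace ℝ d, ‖ξ‖ < r₀ → k ξ = 0) (he : ‖e‖ = 1)
    (hr₀ : 0 < r₀) {s : ℝ} (hs : s < r₀ ^ 2) : sqProfile k e s = 0 := by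
  apply h0
  rw [norm_sqrt_smul he]
  exact (Real.sqrt_lt' hr₀).2 hs

omit [DecidableEq d] in
/-- The square profile vanishes on `[R², ∞)` if `k` vanishes outside the open ball of radius `R ≥ 0`. [folklore] -/
theorem sqProfile_eq_zero_of_le (hR : ∀ ξ : EuclideanSpace ℝ d, R ≤ ‖ξ‖ → k ξ = 0) (he : ‖e‖ = 1)
    (hR0 : 0 ≤ R) {s : ℝ} (hs : R ^ 2 ≤ s) : sqProfile k e s = 0 := by
  apply hR
  rw [norm_sqrt_smul he]
  exact (Real.le_sqrt hR0 ((sq_nonneg R).trans hs)).2 hs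

omit [DecidableEq d] in
/-- **Smoothness of the square profile**: if `k` is smooth and vanishes on a ball around the origin,
then `s ↦ k(√s e)` is smooth on `ℝ` (it vanishes near `(−∞, r₀²)`, and `√` is smooth on `s ≠ 0`). [folklore] -/
theorem contDiff_sqProfile (hk : ContDiff ℝ ∞ k) (h0 : ∀ ξ : EuclideanSpace ℝ d, ‖ξ‖ < r₀ → k ξ = 0)
    (he : ‖e‖ = 1) (hr₀ : 0 < r₀) : ContDiff ℝ ∞ (sqProfile k e) := by
  refine contDiff_iff_contDiffAt.2 fun s => ?_
  by_cases hs : s < r₀ ^ 2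
  · have h : (fun _ : ℝ => (0 : ℝ)) =ᶠ[𝓝 s] sqProfile k e := by
      filter_upwards [Iio_mem_nhds hs] with s' hs'
      exact (sqProfile_eq_zero_of_lt h0 he hr₀ hs').symm
    exact (contDiffAt_const (c := (0 : ℝ))).congr_of_eventuallyEq h.symm
  · have hs0 : s ≠ 0 := by
      rintro rfl
      exact hs (by positivity)
    have h1 : ContDiffAt ℝ ∞ Real.sqrt s := Real.contDiffAt_sqrt hs0
    exact hk.contDiffAt.comp s (h1.smul contDiffAt_const)

/-- **Division by `s`** preserves smoothness for profiles vanishing near `(−∞, a)`, `a > 0`: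
`s ↦ G(s)/s` is smooth (junk `G(0)/0 = 0` consistent). [folklore] -/
theorem contDiff_div_self_of_eq_zero {G : ℝ → ℝ} (hG : ContDiff ℝ ∞ G) {a : ℝ} (ha : 0 < a)
    (h0 : ∀ s, s < a → G s = 0) : ContDiff ℝ ∞ fun s => G s / s := by
  refine contDiff_iff_contDiffAt.2 fun s => ?_
  by_cases hs : s < a
  · have h : (fun _ : ℝ => (0 : ℝ)) =ᶠ[𝓝 s] fun s => G s / s := by
      filter_upwards [Iio_mem_nhds hs] with s' hs'
      simp [h0 s' hs']
    exact (contDiffAt_const (c := (0 : ℝ))).congr_of_eventuallyEq h.symm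
  · have hs0 : s ≠ 0 := by
      rintro rfl
      exact hs ha
    exact hG.contDiffAt.div contDiffAt_id hs0

/-- The derivative of `s ↦ G(s)/s`: `(G' s − G)/s²`, valid at every `s` (at `s = 0` both sides are
the junk value `0`) when `G` vanishes near `(−∞, a)`, `a > 0`. [folklore] -/
theorem hasDerivAt_div_self_of_eq_zero {G : ℝ → ℝ} (hG : ContDiff ℝ ∞ G) {a : ℝ} (ha : 0 < a)
    (h0 : ∀ s, s < a → G s = 0) (s : ℝ) :
    HasDerivAt (fun s => G s / s) ((deriv G s * s - G s) / s ^ 2) s := by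
  by_cases hs0 : s = 0
  · subst hs0
    have h : (fun _ : ℝ => (0 : ℝ)) =ᶠ[𝓝 (0 : ℝ)] fun s => G s / s := by
      filter_upwards [Iio_mem_nhds ha] with s' hs'
      simp [h0 s' hs']
    have := (hasDerivAt_const (0 : ℝ) (0 : ℝ)).congr_of_eventuallyEq h.symm
    simpa using this
  · have hGd : HasDerivAt G (deriv G s) s := ((hG.differentiable (by simp)) s).hasDerivAt
    have := hGd.div (hasDerivAt_id' s) hs0
    simp only [mul_one] at this
    exact this

/-- The derivative of a profile vanishing near `(−∞, a)` vanishes there too. [folklore] -/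
theorem deriv_eq_zero_of_eq_zero {G : ℝ → ℝ} {a : ℝ} (h0 : ∀ s, s < a → G s = 0) {s : ℝ} (hs : s < a) :
    deriv G s = 0 := by
  have h : (fun _ : ℝ => (0 : ℝ)) =ᶠ[𝓝 s] G := by
    filter_upwards [Iio_mem_nhds hs] with s' hs'
    exact (h0 s' hs').symm
  rw [← h.deriv_eq]
  exact deriv_const s 0

end Profile

/-! ## Eyink's transverse and longitudinal potentials `φ_T`, `φ_L` as profiles -/

section Potential

variable {G : ℝ → ℝ} {a R : ℝ}

variable (d) in
/-- **The transverse potential profile** `Z_T(s) = ((d−1)/2) ∫_s^∞ G(τ) dτ/τ`: for `k(y) = G(|y|²)`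
spherically symmetric, `Z_T(|ξ|²) = (d−1)∫_{1}^∞ k(s'ξ) ds'/s' = φ_T(ξ)` is Eyink's transverse kernel
(Eyink 2003, (phi-LT): `φ_T(ℓ) = 2∫_ℓ^∞ φ(ℓ')dℓ'/ℓ'` in `d = 3`; the substitution `τ = s'²|ξ|²`). [cite: Eyink2003, §2 (phi-LT)] -/
def transPotentialProfile (G : ℝ → ℝ) (s : ℝ) : ℝ :=
  ((Fintype.card d : ℝ) - 1) / 2 * ∫ τ in Ioi s, G τ / τ

variable (d) in
/-- **The longitudinal potential profile** `Z_L = G − Z_T` (Eyink 2003, (phi-LT): `φ_L = φ − φ_T`). [cite: Eyink2003, §2 (phi-LT)] -/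
def longPotentialProfile (G : ℝ → ℝ) (s : ℝ) : ℝ :=
  G s - transPotentialProfile d G s

omit [DecidableEq d] in
/-- A smooth profile vanishing near `(−∞, a)` (`a > 0`) and on `[R², ∞)` has `G(τ)/τ` continuous,
integrable, and vanishing in the same regions. [folklore] -/
theorem integrable_div_self {G : ℝ → ℝ} (hG : ContDiff ℝ ∞ G) (ha : 0 < a) (h0 : ∀ s, s < a → G s = 0)
    (hR : ∀ s, R ^ 2 ≤ s → G s = 0) : Integrable (fun τ => G τ / τ) volume := by
  have hc : Continuous fun τ => G τ / τ := (contDiff_div_self_of_eq_zero hG ha h0).continuous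
  refine hc.integrable_of_hasCompactSupport ?_
  refine HasCompactSupport.of_support_subset_isCompact (isCompact_Icc (a := 0) (b := R ^ 2)) ?_
  intro τ hτ
  rw [mem_support] at hτ
  refine ⟨?_, ?_⟩
  · by_contra h
    exact hτ (by simp [h0 τ ((not_le.1 h).trans ha)])
  · by_contra h
    exact hτ (by simp [hR τ (not_le.1 h).le])

omit [DecidableEq d] in
/-- **The transverse potential profile is a primitive**: `Z_T' (s) = −((d−1)/2) G(s)/s` at every
`s` (Eyink 2003, (grad-phi-L): `φ_L' = φ' + (d−1)φ/ℓ`, i.e. `φ_T' = −(d−1)φ/ℓ`). [cite: Eyink2003, §2 (grad-phi-L)] -/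
theorem hasDerivAt_transPotentialProfile (hG : ContDiff ℝ ∞ G) (ha : 0 < a) (h0 : ∀ s, s < a → G s = 0)
    (hR : ∀ s, R ^ 2 ≤ s → G s = 0) (s : ℝ) :
    HasDerivAt (transPotentialProfile d G) (-(((Fintype.card d : ℝ) - 1) / 2 * (G s / s))) s := by
  set h : ℝ → ℝ := fun τ => G τ / τ with hh
  have hc : Continuous h := (contDiff_div_self_of_eq_zero hG ha h0).continuous
  have hi : Integrable h volume := integrable_div_self hG ha h0 hR
  -- `∫_{Ioi s'} h = ∫_{Ioi s} h - ∫_{s..s'} h`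
  have hsplit : ∀ s', transPotentialProfile d G s' =
      ((Fintype.card d : ℝ) - 1) / 2 * ((∫ τ in Ioi s, h τ) - ∫ τ in s..s', h τ) := by
    intro s'
    rw [transPotentialProfile, ← intervalIntegral.integral_Ioi_sub_Ioi' hi.integrableOn hi.integrableOn]
    ring
  have hF : HasDerivAt (fun s' => ∫ τ in s..s', h τ) (h s) s :=
    (hc.integral_hasStrictDerivAt s s).hasDerivAt
  have h2 : HasDerivAt (fun s' => ((Fintype.card d : ℝ) - 1) / 2 * ((∫ τ in Ioi s, h τ) - ∫ τ in s..s', h τ))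
      (((Fintype.card d : ℝ) - 1) / 2 * (0 - h s)) s :=
    ((hasDerivAt_const _ _).sub hF).const_mul _
  have heq : transPotentialProfile d G = fun s' =>
      ((Fintype.card d : ℝ) - 1) / 2 * ((∫ τ in Ioi s, h τ) - ∫ τ in s..s', h τ) := funext hsplit
  rw [heq]
  convert h2 using 1
  simp [hh]

omit [DecidableEq d] in
/-- The transverse potential profile is smooth. [folklore] -/
theorem contDiff_transPotentialProfile (hG : ContDiff ℝ ∞ G) (ha : 0 < a) (h0 : ∀ s, s < a → G s = 0)
    (hR : ∀ s, R ^ 2 ≤ s → G s = 0) : ContDiff ℝ ∞ (transPotentialProfile d G) := by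
  have hd : ∀ s, HasDerivAt (transPotentialProfile d G) (-(((Fintype.card d : ℝ) - 1) / 2 * (G s / s))) s :=
    hasDerivAt_transPotentialProfile hG ha h0 hR
  rw [contDiff_infty_iff_deriv]
  refine ⟨fun s => (hd s).differentiableAt, ?_⟩
  have : deriv (transPotentialProfile d G) = fun s => -(((Fintype.card d : ℝ) - 1) / 2 * (G s / s)) :=
    funext fun s => (hd s).deriv
  rw [this]
  exact (contDiff_const.mul (contDiff_div_self_of_eq_zero hG ha h0)).neg

omit [DecidableEq d] in
/-- The transverse potential profile vanishes on `[R², ∞)`. [folklore] -/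
theorem transPotentialProfile_eq_zero (hR : ∀ s, R ^ 2 ≤ s → G s = 0) {s : ℝ} (hs : R ^ 2 ≤ s) :
    transPotentialProfile d G s = 0 := by
  rw [transPotentialProfile, setIntegral_eq_zero_of_forall_eq_zero fun τ hτ => ?_, mul_zero]
  simp [hR τ (hs.trans (le_of_lt hτ))]

omit [DecidableEq d] in
/-- The longitudinal potential profile is smooth. [folklore] -/
theorem contDiff_longPotentialProfile (hG : ContDiff ℝ ∞ G) (ha : 0 < a) (h0 : ∀ s, s < a → G s = 0)
    (hR : ∀ s, R ^ 2 ≤ s → G s = 0) : ContDiff ℝ ∞ (longPotentialProfile d G) :=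
  hG.sub (contDiff_transPotentialProfile hG ha h0 hR)

omit [DecidableEq d] in
/-- The longitudinal potential profile vanishes on `[R², ∞)`. [folklore] -/
theorem longPotentialProfile_eq_zero (hR : ∀ s, R ^ 2 ≤ s → G s = 0) {s : ℝ} (hs : R ^ 2 ≤ s) :
    longPotentialProfile d G s = 0 := by
  rw [longPotentialProfile, transPotentialProfile_eq_zero hR hs, hR s hs, sub_zero]

omit [DecidableEq d] in
/-- **Eyink's transverse divergence identity, profile form**: with `A = G`, `B = −G(s)/s`,
`Z_T' = A' + sB' + ((d+1)/2)B` (so `∑ᵢ∂ᵢ[(δᵢⱼ − ŷᵢŷⱼ)k] = ∂ⱼ φ_T`, Eyink 2003, `∇·Π_T = ∇p_T`). [cite: Eyink2003, §2 (Pi-p-LT)] -/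
theorem hasDerivAt_transPotentialProfile_eq (hG : ContDiff ℝ ∞ G) (ha : 0 < a) (h0 : ∀ s, s < a → G s = 0)
    (hR : ∀ s, R ^ 2 ≤ s → G s = 0) (s : ℝ) :
    HasDerivAt (transPotentialProfile d G)
      (deriv G s + s * deriv (fun s => -(G s / s)) s +
        (((Fintype.card d : ℝ) + 1) / 2) * (-(G s / s))) s := by
  have h := hasDerivAt_transPotentialProfile (d := d) hG ha h0 hR s
  have hB : deriv (fun s => -(G s / s)) s = -((deriv G s * s - G s) / s ^ 2) :=
    (hasDerivAt_div_self_of_eq_zero hG ha h0 s).neg.deriv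
  convert h using 1
  rw [hB]
  by_cases hs : s = 0
  · subst hs
    simp [h0 0 ha, deriv_eq_zero_of_eq_zero h0 ha]
  · field_simp
    ring

omit [DecidableEq d] in
/-- **Eyink's longitudinal divergence identity, profile form**: with `A = 0`, `B = G(s)/s`,
`Z_L' = A' + sB' + ((d+1)/2)B` (`∇·[(ŷ⊗ŷ)k] = ∇φ_L`, Eyink 2003, (grad-Pi-L)–(grad-phi-L)). [cite: Eyink2003, §2 (grad-Pi-L)–(grad-phi-L)] -/
theorem hasDerivAt_longPotentialProfile_eq (hG : ContDiff ℝ ∞ G) (ha : 0 < a) (h0 : ∀ s, s < a → G s = 0)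
    (hR : ∀ s, R ^ 2 ≤ s → G s = 0) (s : ℝ) :
    HasDerivAt (longPotentialProfile d G)
      (deriv (fun _ : ℝ => (0 : ℝ)) s + s * deriv (fun s => G s / s) s +
        (((Fintype.card d : ℝ) + 1) / 2) * (G s / s)) s := by
  have hT := hasDerivAt_transPotentialProfile (d := d) hG ha h0 hR s
  have hGd : HasDerivAt G (deriv G s) s := ((hG.differentiable (by simp)) s).hasDerivAt
  have h : HasDerivAt (longPotentialProfile d G)
      (deriv G s - -(((Fintype.card d : ℝ) - 1) / 2 * (G s / s))) s := hGd.sub hT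
  have hB : deriv (fun s => G s / s) s = (deriv G s * s - G s) / s ^ 2 :=
    (hasDerivAt_div_self_of_eq_zero hG ha h0 s).deriv
  convert h using 1
  rw [hB, deriv_const]
  by_cases hs : s = 0
  · subst hs
    simp [h0 0 ha, deriv_eq_zero_of_eq_zero h0 ha]
  · field_simp
    ring

end Potential

/-! ## Eyink's kernels `(1 − ŷ⊗ŷ)k` and `(ŷ⊗ŷ)k` in profile form -/

section EyinkEuclidean

variable {G : ℝ → ℝ} {a R : ℝ}

/-- **Eyink's transverse matrix kernel on `ℝ^d`** in profile form,
`m_T^{ij}(y) = G(|y|²)δᵢⱼ − (G(|y|²)/|y|²) yᵢyⱼ = (δᵢⱼ − ŷᵢŷⱼ) k(y)` for `k(y) = G(|y|²)`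
(Eyink 2003, (u-LT): `u_T = (1 − ℓ̂⊗ℓ̂)u`, mollified with `φ^ε(ℓ)`). [cite: Eyink2003, §2 (u-LT)–(moll-u-LT)] -/
def eyinkMatKernelTE (G : ℝ → ℝ) : d → d → EuclideanSpace ℝ d → ℝ :=
  radMatKernelE G fun s => -(G s / s)

/-- **Eyink's longitudinal matrix kernel on `ℝ^d`** in profile form,
`m_L^{ij}(y) = (G(|y|²)/|y|²) yᵢyⱼ = ŷᵢŷⱼ k(y)` (Eyink 2003, (u-LT): `u_L = (ℓ̂⊗ℓ̂)u`). [cite: Eyink2003, §2 (u-LT)–(moll-u-LT)] -/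
def eyinkMatKernelLE (G : ℝ → ℝ) : d → d → EuclideanSpace ℝ d → ℝ :=
  radMatKernelE (fun _ => 0) fun s => G s / s

omit [DecidableEq d] in
/-- `ŷᵢ ŷⱼ = yᵢyⱼ/|y|²` for `ŷ = |y|⁻¹ y` (junk-consistent at `y = 0`). [folklore] -/
theorem unitDir_apply_mul_unitDir_apply (y : EuclideanSpace ℝ d) (i j : d) :
    (‖y‖⁻¹ • y) i * (‖y‖⁻¹ • y) j = (‖y‖ ^ 2)⁻¹ * (y i * y j) := by
  simp only [PiLp.smul_apply, smul_eq_mul, ← inv_pow]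
  ring

/-- `m_T^{ij}(y) = k(y)(δᵢⱼ − ŷᵢŷⱼ)` with `k(y) = G(|y|²)`, `ŷ = |y|⁻¹y` (junk-consistent at `y = 0`). [folklore] -/
theorem eyinkMatKernelTE_apply (G : ℝ → ℝ) (i j : d) (y : EuclideanSpace ℝ d) :
    eyinkMatKernelTE G i j y =
      G (‖y‖ ^ 2) * ((if i = j then 1 else 0) - (‖y‖⁻¹ • y) i * (‖y‖⁻¹ • y) j) := by
  rw [unitDir_apply_mul_unitDir_apply, eyinkMatKernelTE, radMatKernelE_apply, div_eq_mul_inv]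
  ring

/-- `m_L^{ij}(y) = k(y) ŷᵢŷⱼ`. [folklore] -/
theorem eyinkMatKernelLE_apply (G : ℝ → ℝ) (i j : d) (y : EuclideanSpace ℝ d) :
    eyinkMatKernelLE G i j y = G (‖y‖ ^ 2) * ((‖y‖⁻¹ • y) i * (‖y‖⁻¹ • y) j) := by
  rw [unitDir_apply_mul_unitDir_apply, eyinkMatKernelLE, radMatKernelE_apply, div_eq_mul_inv]
  ring

/-- `m_L + m_T = k · 1`. [folklore] -/
theorem eyinkMatKernelLE_add_eyinkMatKernelTE (G : ℝ → ℝ) (i j : d) (y : EuclideanSpace ℝ d) :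
    eyinkMatKernelLE G i j y + eyinkMatKernelTE G i j y = G (‖y‖ ^ 2) * (if i = j then 1 else 0) := by
  rw [eyinkMatKernelTE_apply, eyinkMatKernelLE_apply]
  ring

/-- The transverse kernel is even. [folklore] -/
theorem eyinkMatKernelTE_neg (G : ℝ → ℝ) (i j : d) (y : EuclideanSpace ℝ d) :
    eyinkMatKernelTE G i j (-y) = eyinkMatKernelTE G i j y :=
  radMatKernelE_neg _ _ i j y

/-- The longitudinal kernel is even. [folklore] -/
theorem eyinkMatKernelLE_neg (G : ℝ → ℝ) (i j : d) (y : EuclideanSpace ℝ d) :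
    eyinkMatKernelLE G i j (-y) = eyinkMatKernelLE G i j y :=
  radMatKernelE_neg _ _ i j y

/-- The transverse kernel is symmetric. [folklore] -/
theorem eyinkMatKernelTE_comm (G : ℝ → ℝ) (i j : d) : eyinkMatKernelTE (d := d) G i j = eyinkMatKernelTE G j i :=
  radMatKernelE_comm _ _ i j

/-- The longitudinal kernel is symmetric. [folklore] -/
theorem eyinkMatKernelLE_comm (G : ℝ → ℝ) (i j : d) : eyinkMatKernelLE (d := d) G i j = eyinkMatKernelLE G j i :=
  radMatKernelE_comm _ _ i j

/-- The transverse kernel is smooth for a smooth profile vanishing near `(−∞, a)`, `a > 0`. [folklore] -/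
theorem contDiff_eyinkMatKernelTE (hG : ContDiff ℝ ∞ G) (ha : 0 < a) (h0 : ∀ s, s < a → G s = 0) (i j : d) :
    ContDiff ℝ ∞ (eyinkMatKernelTE G i j) :=
  contDiff_radMatKernelE hG (contDiff_div_self_of_eq_zero hG ha h0).neg i j

/-- The longitudinal kernel is smooth for a smooth profile vanishing near `(−∞, a)`, `a > 0`. [folklore] -/
theorem contDiff_eyinkMatKernelLE (hG : ContDiff ℝ ∞ G) (ha : 0 < a) (h0 : ∀ s, s < a → G s = 0) (i j : d) :
    ContDiff ℝ ∞ (eyinkMatKernelLE G i j) :=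
  contDiff_radMatKernelE contDiff_const (contDiff_div_self_of_eq_zero hG ha h0) i j

/-- Support of the transverse kernel. [folklore] -/
theorem tsupport_eyinkMatKernelTE_subset (hR0 : 0 ≤ R) (hR : ∀ s, R ^ 2 ≤ s → G s = 0) (i j : d) :
    tsupport (eyinkMatKernelTE G i j) ⊆ closedBall (0 : EuclideanSpace ℝ d) R :=
  tsupport_radMatKernelE_subset hR0 hR (fun s hs => by simp [hR s hs]) i j

/-- Support of the longitudinal kernel. [folklore] -/
theorem tsupport_eyinkMatKernelLE_subset (hR0 : 0 ≤ R) (hR : ∀ s, R ^ 2 ≤ s → G s = 0) (i j : d) :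
    tsupport (eyinkMatKernelLE G i j) ⊆ closedBall (0 : EuclideanSpace ℝ d) R :=
  tsupport_radMatKernelE_subset hR0 (fun _ _ => rfl) (fun s hs => by simp [hR s hs]) i j

/-- **`∇·[(1 − ŷ⊗ŷ)k] = ∇φ_T` on `ℝ^d`** (Eyink 2003, (Pi-p-LT): `∇·Π_T^ε = ∇p_T^ε`). [cite: Eyink2003, §2 (Pi-p-LT)] -/
theorem sum_fderiv_eyinkMatKernelTE (hG : ContDiff ℝ ∞ G) (ha : 0 < a) (h0 : ∀ s, s < a → G s = 0)
    (hR : ∀ s, R ^ 2 ≤ s → G s = 0) (j : d) (y : EuclideanSpace ℝ d) :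
    ∑ i, fderiv ℝ (eyinkMatKernelTE G i j) y (EuclideanSpace.single i 1) =
      fderiv ℝ (fun x : EuclideanSpace ℝ d => transPotentialProfile d G (‖x‖ ^ 2)) y
        (EuclideanSpace.single j 1) :=
  sum_fderiv_radMatKernelE hG (contDiff_div_self_of_eq_zero hG ha h0).neg
    (hasDerivAt_transPotentialProfile_eq hG ha h0 hR) j y

/-- **`∇·[(ŷ⊗ŷ)k] = ∇φ_L` on `ℝ^d`** (Eyink 2003, (grad-Pi-L)–(grad-phi-L)). [cite: Eyink2003, §2 (grad-Pi-L)–(grad-phi-L)] -/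
theorem sum_fderiv_eyinkMatKernelLE (hG : ContDiff ℝ ∞ G) (ha : 0 < a) (h0 : ∀ s, s < a → G s = 0)
    (hR : ∀ s, R ^ 2 ≤ s → G s = 0) (j : d) (y : EuclideanSpace ℝ d) :
    ∑ i, fderiv ℝ (eyinkMatKernelLE G i j) y (EuclideanSpace.single i 1) =
      fderiv ℝ (fun x : EuclideanSpace ℝ d => longPotentialProfile d G (‖x‖ ^ 2)) y
        (EuclideanSpace.single j 1) :=
  sum_fderiv_radMatKernelE contDiff_const (contDiff_div_self_of_eq_zero hG ha h0)
    (hasDerivAt_longPotentialProfile_eq hG ha h0 hR) j y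

omit [DecidableEq d] in
/-- The gradient pairing of a kernel in profile form: `⟪∇k(y), v⟫ = 2G'(|y|²)⟪y, v⟫`. [folklore] -/
theorem inner_gradient_of_profile (hG : ContDiff ℝ ∞ G) {k : EuclideanSpace ℝ d → ℝ}
    (hk : ∀ y, k y = G (‖y‖ ^ 2)) (y v : EuclideanSpace ℝ d) :
    ⟪gradient k y, v⟫ = 2 * deriv G (‖y‖ ^ 2) * ⟪y, v⟫ := by
  have hkf : k = fun y => G (‖y‖ ^ 2) := funext hk
  have hN : HasFDerivAt (fun x : EuclideanSpace ℝ d => ‖x‖ ^ 2) (2 • innerSL ℝ y) y :=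
    (hasStrictFDerivAt_norm_sq y).hasFDerivAt
  have hGd : HasDerivAt G (deriv G (‖y‖ ^ 2)) (‖y‖ ^ 2) := ((hG.differentiable (by simp)) _).hasDerivAt
  have h : HasFDerivAt k ((deriv G (‖y‖ ^ 2)) • (2 • innerSL ℝ y)) y := by
    rw [hkf]
    exact HasDerivAt.comp_hasFDerivAt (h₂ := G) (f := fun x : EuclideanSpace ℝ d => ‖x‖ ^ 2) y hGd hN
  rw [gradient, h.fderiv, InnerProductSpace.toDual_symm_apply]
  simp only [smul_apply, innerSL_apply_apply, smul_eq_mul]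
  ring

/-- **The cubic contraction of Eyink's transverse kernel gradient is the transverse integrand**:
for every vector `v` (the increment `δu`), with `k(y) = G(|y|²)`, `ŷ = |y|⁻¹y`, `v_L = ⟪v, ŷ⟫`,
`|v_T|² = |v|² − v_L²`,
`∑ᵢⱼₗ ∂ₗ m_T^{ij}(y) vᵢvⱼvₗ = ⟪∇k(y), v⟫|v_T|² − (2/|y|) k(y) v_L |v_T|²`
(Eyink 2003, (id-T), first equality). [cite: Eyink2003, §2 (id-T)] -/
theorem sum_fderiv_eyinkMatKernelTE_mul (hG : ContDiff ℝ ∞ G) (ha : 0 < a) (h0 : ∀ s, s < a → G s = 0)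
    {k : EuclideanSpace ℝ d → ℝ} (hk : ∀ y, k y = G (‖y‖ ^ 2)) (v y : EuclideanSpace ℝ d) :
    ∑ i, ∑ j, ∑ l, fderiv ℝ (eyinkMatKernelTE G i j) y (EuclideanSpace.single l 1) * (v i * v j * v l) =
      ⟪gradient k y, v⟫ * (‖v‖ ^ 2 - ⟪v, ‖y‖⁻¹ • y⟫ ^ 2) -
        2 * ‖y‖⁻¹ * k y * ⟪v, ‖y‖⁻¹ • y⟫ * (‖v‖ ^ 2 - ⟪v, ‖y‖⁻¹ • y⟫ ^ 2) := by
  have hB : deriv (fun s => -(G s / s)) (‖y‖ ^ 2) = -((deriv G (‖y‖ ^ 2) * ‖y‖ ^ 2 - G (‖y‖ ^ 2)) / (‖y‖ ^ 2) ^ 2) :=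
    (hasDerivAt_div_self_of_eq_zero hG ha h0 _).neg.deriv
  rw [eyinkMatKernelTE, sum_fderiv_radMatKernelE_mul_mul_mul hG (contDiff_div_self_of_eq_zero hG ha h0).neg,
    inner_gradient_of_profile hG hk, hk y, hB, real_inner_smul_right, real_inner_comm y v]
  by_cases hy : y = 0
  · subst hy
    simp
  · have hn : ‖y‖ ≠ 0 := norm_ne_zero_iff.2 hy
    field_simp
    ring

/-- **The cubic contraction of Eyink's longitudinal kernel gradient is the longitudinal
integrand**: `∑ᵢⱼₗ ∂ₗ m_L^{ij}(y) vᵢvⱼvₗ = ⟪∇k(y), v⟫ v_L² + (2/|y|) k(y) v_L |v_T|²`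
(Eyink 2003, (id-L), first equality). [cite: Eyink2003, §2 (id-L)] -/
theorem sum_fderiv_eyinkMatKernelLE_mul (hG : ContDiff ℝ ∞ G) (ha : 0 < a) (h0 : ∀ s, s < a → G s = 0)
    {k : EuclideanSpace ℝ d → ℝ} (hk : ∀ y, k y = G (‖y‖ ^ 2)) (v y : EuclideanSpace ℝ d) :
    ∑ i, ∑ j, ∑ l, fderiv ℝ (eyinkMatKernelLE G i j) y (EuclideanSpace.single l 1) * (v i * v j * v l) =
      ⟪gradient k y, v⟫ * ⟪v, ‖y‖⁻¹ • y⟫ ^ 2 +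
        2 * ‖y‖⁻¹ * k y * ⟪v, ‖y‖⁻¹ • y⟫ * (‖v‖ ^ 2 - ⟪v, ‖y‖⁻¹ • y⟫ ^ 2) := by
  rw [eyinkMatKernelLE, sum_fderiv_radMatKernelE_mul_mul_mul contDiff_const (contDiff_div_self_of_eq_zero hG ha h0),
    inner_gradient_of_profile hG hk, hk y, (hasDerivAt_div_self_of_eq_zero hG ha h0 _).deriv,
    real_inner_smul_right, real_inner_comm y v, deriv_const]
  by_cases hy : y = 0
  · subst hy
    simp
  · have hn : ‖y‖ ≠ 0 := norm_ne_zero_iff.2 hy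
    field_simp
    ring

end EyinkEuclidean

/-! ## The periodised kernels and potentials on `T^d` -/

section Torus

variable {G : ℝ → ℝ} {a R : ℝ}

/-- **Eyink's transverse matrix kernel on the torus**: the periodisation of `m_T^{ij}` (entrywise;
for kernels supported in a ball of radius `< 1/2` the lattice translates are disjoint). [cite: Eyink2003, §2 (u-LT)–(moll-u-LT)] -/
def eyinkMatKernelT (G : ℝ → ℝ) (i j : d) : UnitAddTorus d → ℝ :=
  FunctionSpaces.Torus.periodize (eyinkMatKernelTE G i j)

/-- **Eyink's longitudinal matrix kernel on the torus**: the periodisation of `m_L^{ij}`. [cite: Eyink2003, §2 (u-LT)–(moll-u-LT)] -/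
def eyinkMatKernelL (G : ℝ → ℝ) (i j : d) : UnitAddTorus d → ℝ :=
  FunctionSpaces.Torus.periodize (eyinkMatKernelLE G i j)

variable (d) in
/-- **Eyink's transverse pressure kernel `φ_T` on the torus**: the periodisation of
`y ↦ Z_T(|y|²)`. [cite: Eyink2003, §2 (phi-LT)] -/
def eyinkPotentialT (G : ℝ → ℝ) : UnitAddTorus d → ℝ :=
  FunctionSpaces.Torus.periodize fun y : EuclideanSpace ℝ d => transPotentialProfile d G (‖y‖ ^ 2)

variable (d) in
/-- **Eyink's longitudinal pressure kernel `φ_L` on the torus**: the periodisation of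
`y ↦ Z_L(|y|²)`. [cite: Eyink2003, §2 (phi-LT)] -/
def eyinkPotentialL (G : ℝ → ℝ) : UnitAddTorus d → ℝ :=
  FunctionSpaces.Torus.periodize fun y : EuclideanSpace ℝ d => longPotentialProfile d G (‖y‖ ^ 2)

omit [DecidableEq d] in
/-- A radial scalar `y ↦ Z(|y|²)` with `Z` vanishing on `[R², ∞)` is supported in the closed ball of
radius `R ≥ 0`. [folklore] -/
theorem tsupport_comp_norm_sq_subset {Z : ℝ → ℝ} (hR0 : 0 ≤ R) (hZ : ∀ s, R ^ 2 ≤ s → Z s = 0) :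
    tsupport (fun y : EuclideanSpace ℝ d => Z (‖y‖ ^ 2)) ⊆ closedBall (0 : EuclideanSpace ℝ d) R :=
  tsupport_subset_closedBall_of_eq_zero fun _ hy => hZ _ (pow_le_pow_left₀ hR0 hy 2)

/-- The torus transverse kernel is smooth. [folklore] -/
theorem isSmooth_eyinkMatKernelT (hG : ContDiff ℝ ∞ G) (ha : 0 < a) (h0 : ∀ s, s < a → G s = 0)
    (hR0 : 0 ≤ R) (hR : ∀ s, R ^ 2 ≤ s → G s = 0) (i j : d) :
    FunctionSpaces.Torus.IsSmooth (eyinkMatKernelT G i j) :=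
  FunctionSpaces.Torus.isSmooth_periodize (contDiff_eyinkMatKernelTE hG ha h0 i j)
    (tsupport_eyinkMatKernelTE_subset hR0 hR i j)

/-- The torus longitudinal kernel is smooth. [folklore] -/
theorem isSmooth_eyinkMatKernelL (hG : ContDiff ℝ ∞ G) (ha : 0 < a) (h0 : ∀ s, s < a → G s = 0)
    (hR0 : 0 ≤ R) (hR : ∀ s, R ^ 2 ≤ s → G s = 0) (i j : d) :
    FunctionSpaces.Torus.IsSmooth (eyinkMatKernelL G i j) :=
  FunctionSpaces.Torus.isSmooth_periodize (contDiff_eyinkMatKernelLE hG ha h0 i j)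
    (tsupport_eyinkMatKernelLE_subset hR0 hR i j)

/-- The torus transverse potential is smooth. [folklore] -/
theorem isSmooth_eyinkPotentialT (hG : ContDiff ℝ ∞ G) (ha : 0 < a) (h0 : ∀ s, s < a → G s = 0)
    (hR0 : 0 ≤ R) (hR : ∀ s, R ^ 2 ≤ s → G s = 0) :
    FunctionSpaces.Torus.IsSmooth (eyinkPotentialT d G) :=
  FunctionSpaces.Torus.isSmooth_periodize (contDiff_comp_norm_sq (contDiff_transPotentialProfile hG ha h0 hR))
    (tsupport_comp_norm_sq_subset hR0 fun _ hs => transPotentialProfile_eq_zero hR hs)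

/-- The torus longitudinal potential is smooth. [folklore] -/
theorem isSmooth_eyinkPotentialL (hG : ContDiff ℝ ∞ G) (ha : 0 < a) (h0 : ∀ s, s < a → G s = 0)
    (hR0 : 0 ≤ R) (hR : ∀ s, R ^ 2 ≤ s → G s = 0) :
    FunctionSpaces.Torus.IsSmooth (eyinkPotentialL d G) :=
  FunctionSpaces.Torus.isSmooth_periodize (contDiff_comp_norm_sq (contDiff_longPotentialProfile hG ha h0 hR))
    (tsupport_comp_norm_sq_subset hR0 fun _ hs => longPotentialProfile_eq_zero hR hs)

/-- The torus transverse kernel is even. [folklore] -/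
theorem eyinkMatKernelT_neg (G : ℝ → ℝ) (i j : d) (z : UnitAddTorus d) :
    eyinkMatKernelT G i j (-z) = eyinkMatKernelT G i j z :=
  periodize_neg_of_even (eyinkMatKernelTE_neg G i j) z

/-- The torus longitudinal kernel is even. [folklore] -/
theorem eyinkMatKernelL_neg (G : ℝ → ℝ) (i j : d) (z : UnitAddTorus d) :
    eyinkMatKernelL G i j (-z) = eyinkMatKernelL G i j z :=
  periodize_neg_of_even (eyinkMatKernelLE_neg G i j) z

/-- The torus transverse potential is even. [folklore] -/
theorem eyinkPotentialT_neg (G : ℝ → ℝ) (z : UnitAddTorus d) :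
    eyinkPotentialT d G (-z) = eyinkPotentialT d G z :=
  periodize_neg_of_even (fun y => by simp [norm_neg]) z

/-- The torus longitudinal potential is even. [folklore] -/
theorem eyinkPotentialL_neg (G : ℝ → ℝ) (z : UnitAddTorus d) :
    eyinkPotentialL d G (-z) = eyinkPotentialL d G z :=
  periodize_neg_of_even (fun y => by simp [norm_neg]) z

/-- The torus transverse kernel is symmetric. [folklore] -/
theorem eyinkMatKernelT_comm (G : ℝ → ℝ) (i j : d) : eyinkMatKernelT (d := d) G i j = eyinkMatKernelT G j i := by
  unfold eyinkMatKernelT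
  rw [eyinkMatKernelTE_comm]

/-- The torus longitudinal kernel is symmetric. [folklore] -/
theorem eyinkMatKernelL_comm (G : ℝ → ℝ) (i j : d) : eyinkMatKernelL (d := d) G i j = eyinkMatKernelL G j i := by
  unfold eyinkMatKernelL
  rw [eyinkMatKernelLE_comm]

/-- **`∑ᵢ ∂ᵢ M_T^{ij} = ∂ⱼ φ_T` on `T^d`** (Eyink 2003, (Pi-p-LT), periodised; profile supported in
`|y| ≤ R`). [cite: Eyink2003, §2 (Pi-p-LT)] -/
theorem sum_partialDeriv_eyinkMatKernelT (hG : ContDiff ℝ ∞ G) (ha : 0 < a) (h0 : ∀ s, s < a → G s = 0)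
    (hR0 : 0 ≤ R) (hR : ∀ s, R ^ 2 ≤ s → G s = 0) (j : d) (x : UnitAddTorus d) :
    ∑ i, FunctionSpaces.Torus.partialDeriv i (eyinkMatKernelT G i j) x =
      FunctionSpaces.Torus.partialDeriv j (eyinkPotentialT d G) x := by
  obtain ⟨n, hn⟩ := exists_nat_ge (R + Fintype.card d)
  unfold eyinkMatKernelT eyinkPotentialT
  rw [partialDeriv_periodize_eq_sum
    ((contDiff_comp_norm_sq (contDiff_transPotentialProfile hG ha h0 hR)).of_le (by simp))
    (tsupport_comp_norm_sq_subset hR0 fun _ hs => transPotentialProfile_eq_zero hR hs) hn]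
  simp_rw [partialDeriv_periodize_eq_sum ((contDiff_eyinkMatKernelTE hG ha h0 _ _).of_le (by simp))
    (tsupport_eyinkMatKernelTE_subset hR0 hR _ _) hn]
  rw [Finset.sum_comm]
  exact Finset.sum_congr rfl fun k _ => sum_fderiv_eyinkMatKernelTE hG ha h0 hR j _

/-- **`∑ᵢ ∂ᵢ M_L^{ij} = ∂ⱼ φ_L` on `T^d`** (Eyink 2003, (grad-Pi-L)–(grad-phi-L), periodised). [cite: Eyink2003, §2 (grad-Pi-L)–(grad-phi-L)] -/
theorem sum_partialDeriv_eyinkMatKernelL (hG : ContDiff ℝ ∞ G) (ha : 0 < a) (h0 : ∀ s, s < a → G s = 0)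
    (hR0 : 0 ≤ R) (hR : ∀ s, R ^ 2 ≤ s → G s = 0) (j : d) (x : UnitAddTorus d) :
    ∑ i, FunctionSpaces.Torus.partialDeriv i (eyinkMatKernelL G i j) x =
      FunctionSpaces.Torus.partialDeriv j (eyinkPotentialL d G) x := by
  obtain ⟨n, hn⟩ := exists_nat_ge (R + Fintype.card d)
  unfold eyinkMatKernelL eyinkPotentialL
  rw [partialDeriv_periodize_eq_sum
    ((contDiff_comp_norm_sq (contDiff_longPotentialProfile hG ha h0 hR)).of_le (by simp))
    (tsupport_comp_norm_sq_subset hR0 fun _ hs => longPotentialProfile_eq_zero hR hs) hn]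
  simp_rw [partialDeriv_periodize_eq_sum ((contDiff_eyinkMatKernelLE hG ha h0 _ _).of_le (by simp))
    (tsupport_eyinkMatKernelLE_subset hR0 hR _ _) hn]
  rw [Finset.sum_comm]
  exact Finset.sum_congr rfl fun k _ => sum_fderiv_eyinkMatKernelLE hG ha h0 hR j _

end Torus

/-! ## Identification with Eyink's pressure kernels `φ_T`, `φ_L` away from the origin -/

section PressureKernel

variable {G : ℝ → ℝ} {a R : ℝ}

omit [DecidableEq d] in
/-- **`φ_T(ξ) = Z_T(|ξ|²)` for `ξ ≠ 0`**: Eyink's transverse kernel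
`(d−1)∫_{s>1} k(sξ) ds/s` of `k(y) = G(|y|²)` is the transverse potential profile at `|ξ|²`
(the substitution `τ = s²|ξ|²`; Eyink 2003, (phi-LT)). At `ξ = 0` the left side is the junk value
of a divergent integral, which is why the smooth potential is used on the torus. [cite: Eyink2003, §2 (phi-LT)] -/
theorem eyinkTransverseKernel_eq_transPotentialProfile (hG : ContDiff ℝ ∞ G) (ha : 0 < a)
    (h0 : ∀ s, s < a → G s = 0) (hR : ∀ s, R ^ 2 ≤ s → G s = 0) {k : EuclideanSpace ℝ d → ℝ}
    (hk : ∀ y, k y = G (‖y‖ ^ 2)) {ξ : EuclideanSpace ℝ d} (hξ : ξ ≠ 0) :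
    eyinkTransverseKernel d k ξ = transPotentialProfile d G (‖ξ‖ ^ 2) := by
  set c : ℝ := ‖ξ‖ ^ 2 with hc
  have hc0 : 0 < c := by positivity
  -- the two integrands
  set h : ℝ → ℝ := fun s => s⁻¹ * G (s ^ 2 * c) with hh
  set g : ℝ → ℝ := fun τ => G τ / τ with hg
  have hgc : Continuous g := (contDiff_div_self_of_eq_zero hG ha h0).continuous
  have hgi : Integrable g volume := integrable_div_self hG ha h0 hR
  have hks : ∀ s : ℝ, k (s • ξ) = G (s ^ 2 * c) := fun s => by
    rw [hk, norm_smul, mul_pow, Real.norm_eq_abs, sq_abs]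
  -- a threshold beyond which everything vanishes
  set M : ℝ := Real.sqrt (R ^ 2 / c) + 1 with hM
  have hM1 : 1 ≤ M := by
    have := Real.sqrt_nonneg (R ^ 2 / c)
    linarith
  have hMvan : ∀ s, M ≤ s → R ^ 2 ≤ s ^ 2 * c := by
    intro s hs
    have h1 : Real.sqrt (R ^ 2 / c) ≤ s := by linarith
    have h2 : R ^ 2 / c ≤ s ^ 2 := by
      have := pow_le_pow_left₀ (Real.sqrt_nonneg _) h1 2
      rwa [Real.sq_sqrt (by positivity)] at this
    rwa [div_le_iff₀ hc0] at h2
  have hh0 : ∀ s, M ≤ s → h s = 0 := fun s hs => by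
    simp only [hh, hR _ (hMvan s hs), mul_zero]
  -- `h` is integrable on `(1, ∞)`
  have hhc : ContinuousOn h (Icc 1 M) := by
    refine ContinuousOn.mul (continuousOn_inv₀.mono ?_) ?_
    · intro s hs
      exact ne_of_gt (lt_of_lt_of_le one_pos hs.1)
    · exact (hG.continuous.comp (by fun_prop)).continuousOn
  have hhi : IntegrableOn h (Ioi 1) volume := by
    have h1 : IntegrableOn h (Ioc 1 M) volume := (hhc.integrableOn_Icc).mono_set Ioc_subset_Icc_self
    have h2 : IntegrableOn h (Ioi M) volume :=
      (integrableOn_zero (s := Ioi M)).congr_fun (fun s hs => (hh0 s (le_of_lt hs)).symm) measurableSet_Ioi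
    have := h1.union h2
    rwa [Ioc_union_Ioi_eq_Ioi hM1] at this
  -- step 1: `∫_{Ioi 1} h = ∫_{1..M} h`
  have step1 : ∫ s in Ioi (1 : ℝ), h s = ∫ s in (1 : ℝ)..M, h s := by
    rw [← intervalIntegral.integral_Ioi_sub_Ioi hhi hM1,
      setIntegral_eq_zero_of_forall_eq_zero (t := Ioi M) fun s hs => hh0 s (le_of_lt hs), sub_zero]
  -- step 2: substitution `τ = s² c` on `[1, M]`
  have step2 : ∫ s in (1 : ℝ)..M, h s = 2⁻¹ * ∫ τ in c..(M ^ 2 * c), g τ := by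
    have hsub := intervalIntegral.integral_comp_mul_deriv (a := 1) (b := M) (f := fun s => s ^ 2 * c)
      (f' := fun s => 2 * s * c) (g := g) (fun s _ => by
        simpa using ((hasDerivAt_pow 2 s).mul_const c)) (by fun_prop) hgc
    simp only [one_pow, one_mul] at hsub
    rw [← hsub, ← intervalIntegral.integral_const_mul]
    refine intervalIntegral.integral_congr fun s hs => ?_
    rw [uIcc_of_le hM1] at hs
    have hs0 : s ≠ 0 := ne_of_gt (lt_of_lt_of_le one_pos hs.1)
    simp only [hh, hg, comp_apply]
    field_simp
  -- step 3: `∫_{c..M²c} g = ∫_{Ioi c} g`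
  have step3 : ∫ τ in c..(M ^ 2 * c), g τ = ∫ τ in Ioi c, g τ := by
    have hle : c ≤ M ^ 2 * c := le_mul_of_one_le_left hc0.le (one_le_pow₀ hM1)
    rw [← intervalIntegral.integral_Ioi_sub_Ioi hgi.integrableOn hle,
      setIntegral_eq_zero_of_forall_eq_zero (t := Ioi (M ^ 2 * c)) fun τ hτ => ?_, sub_zero]
    have : R ^ 2 ≤ τ := (hMvan M le_rfl).trans (le_of_lt hτ)
    simp [hg, hR τ this]
  -- assemble
  rw [eyinkTransverseKernel_apply, transPotentialProfile]
  simp_rw [hks]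
  change ((Fintype.card d : ℝ) - 1) * ∫ s in Ioi (1 : ℝ), h s = _
  rw [step1, step2, step3]
  ring

omit [DecidableEq d] in
/-- **`φ_L(ξ) = Z_L(|ξ|²)` for `ξ ≠ 0`** (Eyink 2003, (phi-LT): `φ_L = φ − φ_T`). [cite: Eyink2003, §2 (phi-LT)] -/
theorem eyinkLongitudinalKernel_eq_longPotentialProfile (hG : ContDiff ℝ ∞ G) (ha : 0 < a)
    (h0 : ∀ s, s < a → G s = 0) (hR : ∀ s, R ^ 2 ≤ s → G s = 0) {k : EuclideanSpace ℝ d → ℝ}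
    (hk : ∀ y, k y = G (‖y‖ ^ 2)) {ξ : EuclideanSpace ℝ d} (hξ : ξ ≠ 0) :
    eyinkLongitudinalKernel d k ξ = longPotentialProfile d G (‖ξ‖ ^ 2) := by
  rw [eyinkLongitudinalKernel_apply, eyinkTransverseKernel_eq_transPotentialProfile hG ha h0 hR hk hξ, hk,
    longPotentialProfile]

end PressureKernel

/-! ## Contractions of the kernels with vectors; the periodised derivative -/

section Contractions

variable {G : ℝ → ℝ}

/-- `∑ⱼ m_T^{ij}(y) wⱼ = k(y)(wᵢ − ⟪ŷ, w⟫ŷᵢ)`: the transverse kernel acts as `k(y)(1 − ŷ⊗ŷ)`. [folklore] -/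
theorem sum_eyinkMatKernelTE_mul (G : ℝ → ℝ) (i : d) (y w : EuclideanSpace ℝ d) :
    ∑ j, eyinkMatKernelTE G i j y * w j = G (‖y‖ ^ 2) * (w i - ⟪‖y‖⁻¹ • y, w⟫ * (‖y‖⁻¹ • y) i) := by
  simp_rw [eyinkMatKernelTE_apply, mul_sub, sub_mul, Finset.sum_sub_distrib]
  have e1 : ∑ j, G (‖y‖ ^ 2) * (if i = j then (1 : ℝ) else 0) * w j = G (‖y‖ ^ 2) * w i := by
    simp_rw [mul_assoc, ← Finset.mul_sum, boole_mul, Finset.sum_ite_eq, Finset.mem_univ, if_true]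
  have e2 : ∑ j, G (‖y‖ ^ 2) * ((‖y‖⁻¹ • y) i * (‖y‖⁻¹ • y) j) * w j =
      G (‖y‖ ^ 2) * (⟪‖y‖⁻¹ • y, w⟫ * (‖y‖⁻¹ • y) i) := by
    rw [real_inner_eq_sum_mul', Finset.sum_mul, Finset.mul_sum]
    exact Finset.sum_congr rfl fun j _ => by ring
  rw [e1, e2]

/-- `∑ⱼ m_L^{ij}(y) wⱼ = k(y)⟪ŷ, w⟫ŷᵢ`: the longitudinal kernel acts as `k(y) ŷ⊗ŷ`. [folklore] -/
theorem sum_eyinkMatKernelLE_mul (G : ℝ → ℝ) (i : d) (y w : EuclideanSpace ℝ d) :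
    ∑ j, eyinkMatKernelLE G i j y * w j = G (‖y‖ ^ 2) * (⟪‖y‖⁻¹ • y, w⟫ * (‖y‖⁻¹ • y) i) := by
  simp_rw [eyinkMatKernelLE_apply]
  rw [real_inner_eq_sum_mul', Finset.sum_mul, Finset.mul_sum]
  exact Finset.sum_congr rfl fun j _ => by ring

/-- `∑ᵢⱼ m_T^{ij}(y) wᵢwⱼ = k(y)(|w|² − ⟪ŷ,w⟫²)` (`= k(y)|P_T w|²`). [folklore] -/
theorem sum_sum_eyinkMatKernelTE_mul_mul (G : ℝ → ℝ) (y w : EuclideanSpace ℝ d) :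
    ∑ i, ∑ j, eyinkMatKernelTE G i j y * (w i * w j) = G (‖y‖ ^ 2) * (‖w‖ ^ 2 - ⟪‖y‖⁻¹ • y, w⟫ ^ 2) := by
  have h : ∀ i, ∑ j, eyinkMatKernelTE G i j y * (w i * w j) = w i * ∑ j, eyinkMatKernelTE G i j y * w j := fun i => by
    rw [Finset.mul_sum]
    exact Finset.sum_congr rfl fun j _ => by ring
  simp_rw [h, sum_eyinkMatKernelTE_mul]
  have hN : ‖w‖ ^ 2 = ∑ i, w i * w i := by
    rw [← real_inner_self_eq_norm_sq, real_inner_eq_sum_mul']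
  rw [hN, real_inner_eq_sum_mul']
  set S : ℝ := ∑ i, (‖y‖⁻¹ • y) i * w i with hS
  have e : ∀ i, w i * (G (‖y‖ ^ 2) * (w i - S * (‖y‖⁻¹ • y) i)) =
      G (‖y‖ ^ 2) * (w i * w i) - G (‖y‖ ^ 2) * S * ((‖y‖⁻¹ • y) i * w i) := fun i => by ring
  simp_rw [e]
  rw [Finset.sum_sub_distrib, ← Finset.mul_sum, ← Finset.mul_sum]
  ring

/-- `∑ᵢⱼ m_L^{ij}(y) wᵢwⱼ = k(y)⟪ŷ,w⟫²` (`= k(y)|P_L w|²` for `y ≠ 0`). [folklore] -/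
theorem sum_sum_eyinkMatKernelLE_mul_mul (G : ℝ → ℝ) (y w : EuclideanSpace ℝ d) :
    ∑ i, ∑ j, eyinkMatKernelLE G i j y * (w i * w j) = G (‖y‖ ^ 2) * ⟪‖y‖⁻¹ • y, w⟫ ^ 2 := by
  have h : ∀ i, ∑ j, eyinkMatKernelLE G i j y * (w i * w j) = w i * ∑ j, eyinkMatKernelLE G i j y * w j := fun i => by
    rw [Finset.mul_sum]
    exact Finset.sum_congr rfl fun j _ => by ring
  simp_rw [h, sum_eyinkMatKernelLE_mul]
  rw [real_inner_eq_sum_mul']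
  set S : ℝ := ∑ i, (‖y‖⁻¹ • y) i * w i with hS
  have e : ∀ i, w i * (G (‖y‖ ^ 2) * (S * (‖y‖⁻¹ • y) i)) = G (‖y‖ ^ 2) * S * ((‖y‖⁻¹ • y) i * w i) :=
    fun i => by ring
  simp_rw [e]
  rw [← Finset.mul_sum]
  ring

/-- **Partial derivatives commute with periodisation**: for `g ∈ C¹` with bounded support,
`∂ₗ(periodize g) = periodize(∂ₗ g)` on `T^d`. [folklore] -/
theorem partialDeriv_periodize {g : EuclideanSpace ℝ d → ℝ} (hgs : ContDiff ℝ 1 g) {R : ℝ}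
    (hg : tsupport g ⊆ closedBall 0 R) (l : d) (x : UnitAddTorus d) :
    FunctionSpaces.Torus.partialDeriv l (FunctionSpaces.Torus.periodize g) x =
      FunctionSpaces.Torus.periodize (fun y => fderiv ℝ g y (EuclideanSpace.single l 1)) x := by
  obtain ⟨n, hn⟩ := exists_nat_ge (R + Fintype.card d)
  have hx : ‖FunctionSpaces.Torus.repr x‖ ≤ Fintype.card d :=
    FunctionSpaces.Torus.norm_le_card_of_mem_unitCube (FunctionSpaces.Torus.repr_mem_unitCube x)
  have hsupp : support (fun y => fderiv ℝ g y (EuclideanSpace.single l 1)) ⊆ closedBall 0 R := by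
    intro y hy
    refine (support_fderiv_subset ℝ).trans hg ?_
    rw [mem_support] at hy ⊢
    intro h
    exact hy (by simp [h])
  rw [partialDeriv_periodize_eq_sum hgs hg hn, FunctionSpaces.Torus.periodize_apply,
    FunctionSpaces.Torus.perSum_eq_sum hsupp hx hn]

end Contractions

/-! ## Radial bumps and their rescalings; Eyink's integrands as cubic contractions -/

section Bump

/-- A **radial bump**: a smooth, compactly supported, spherically symmetric function on `ℝ^d` — the
regularity and symmetry of the mollifiers in Eyink 2003, Thm. 1 ("`C^∞` … compact support, …
spherically symmetric"), without sign or mass conditions, so that the class is stable under the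
excision `φ ↦ φ(1 − χ(·/κ))` and under differences. [cite: Eyink2003, §2 Thm. 1] -/
structure IsRadialBump (φ : EuclideanSpace ℝ d → ℝ) : Prop where
  smooth : ContDiff ℝ ∞ φ
  hasCompactSupport : HasCompactSupport φ
  radial : ∀ ξ η : EuclideanSpace ℝ d, ‖ξ‖ = ‖η‖ → φ ξ = φ η

variable {φ : EuclideanSpace ℝ d → ℝ} {ε r₀ : ℝ}

omit [DecidableEq d] in
/-- A spherically symmetric mollifier is a radial bump. [folklore] -/
theorem _root_.Literature.Analysis.FluidPDE.IsMollifier.isRadialBump (hφ : FluidPDE.IsMollifier φ)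
    (hrad : ∀ ξ η : EuclideanSpace ℝ d, ‖ξ‖ = ‖η‖ → φ ξ = φ η) : IsRadialBump φ :=
  ⟨hφ.1, hφ.2.1, hrad⟩

omit [DecidableEq d] in
/-- Rescalings `φ^ε` of radial bumps are radial bumps (`ε ≠ 0`). [folklore] -/
theorem IsRadialBump.mollifierScale (hφ : IsRadialBump φ) (hε : ε ≠ 0) :
    IsRadialBump (FluidPDE.mollifierScale ε φ) := by
  refine ⟨?_, ?_, fun ξ η h => ?_⟩
  · unfold FluidPDE.mollifierScale
    exact contDiff_const.mul (hφ.smooth.comp (contDiff_const_smul _))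
  · have h : FluidPDE.mollifierScale ε φ = fun ξ => (ε ^ Fintype.card d)⁻¹ * φ (ε⁻¹ • ξ) := rfl
    rw [h]
    refine HasCompactSupport.mul_left ?_
    exact hφ.hasCompactSupport.comp_smul (inv_ne_zero hε)
  · rw [FluidPDE.mollifierScale_apply, FluidPDE.mollifierScale_apply, hφ.radial (ε⁻¹ • ξ) (ε⁻¹ • η)]
    rw [norm_smul, norm_smul, h]

omit [DecidableEq d] in
/-- A radial bump vanishes outside some ball: `∃ R ≥ 0, |ξ| ≥ R → φ(ξ) = 0`. [folklore] -/
theorem IsRadialBump.exists_eq_zero (hφ : IsRadialBump φ) : ∃ R : ℝ, 0 ≤ R ∧ ∀ ξ, R ≤ ‖ξ‖ → φ ξ = 0 := by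
  obtain ⟨R, hR⟩ := hφ.hasCompactSupport.exists_tsupport_subset_closedBall
  refine ⟨max R 0 + 1, by positivity, fun ξ hξ => image_eq_zero_of_notMem_tsupport fun h => ?_⟩
  have := hR h
  rw [mem_closedBall, dist_zero_right] at this
  linarith [le_max_left R 0]

omit [DecidableEq d] in
/-- If `φ` vanishes on the open ball of radius `r₀`, then `φ^ε` vanishes on the ball of radius
`ε r₀` (`ε > 0`). [folklore] -/
theorem mollifierScale_eq_zero_of_norm_lt (h0 : ∀ ξ : EuclideanSpace ℝ d, ‖ξ‖ < r₀ → φ ξ = 0) (hε : 0 < ε)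
    {ξ : EuclideanSpace ℝ d} (hξ : ‖ξ‖ < ε * r₀) : FluidPDE.mollifierScale ε φ ξ = 0 := by
  rw [FluidPDE.mollifierScale_apply, h0 _ ?_, mul_zero]
  rw [norm_smul, norm_inv, Real.norm_eq_abs, abs_of_pos hε]
  rwa [inv_mul_lt_iff₀ hε]

omit [DecidableEq d] in
/-- If `φ` vanishes off the ball of radius `R`, then `φ^ε` vanishes off the ball of radius `ε R`
(`ε > 0`). [folklore] -/
theorem mollifierScale_eq_zero_of_le_norm {R : ℝ} (hR : ∀ ξ : EuclideanSpace ℝ d, R ≤ ‖ξ‖ → φ ξ = 0) (hε : 0 < ε)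
    {ξ : EuclideanSpace ℝ d} (hξ : ε * R ≤ ‖ξ‖) : FluidPDE.mollifierScale ε φ ξ = 0 := by
  rw [FluidPDE.mollifierScale_apply, hR _ ?_, mul_zero]
  rw [norm_smul, norm_inv, Real.norm_eq_abs, abs_of_pos hε]
  rwa [le_inv_mul_iff₀ hε]

omit [DecidableEq d] in
/-- **The square profile of an excised rescaled bump.** For a radial bump `φ` vanishing on the ball
of radius `r₀ > 0`, `ε > 0` and a unit vector `e`, the profile `G = sqProfile φ^ε e` is smooth,
vanishes on `(−∞, (εr₀)²)` and on `[R², ∞)` for some `R ≥ 0`, and `φ^ε(y) = G(|y|²)`. [folklore] -/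
theorem sqProfile_mollifierScale_facts (hφ : IsRadialBump φ) (hr₀ : 0 < r₀)
    (h0 : ∀ ξ : EuclideanSpace ℝ d, ‖ξ‖ < r₀ → φ ξ = 0) (hε : 0 < ε) {e : EuclideanSpace ℝ d} (he : ‖e‖ = 1) :
    ContDiff ℝ ∞ (sqProfile (FluidPDE.mollifierScale ε φ) e) ∧
      (∀ s, s < (ε * r₀) ^ 2 → sqProfile (FluidPDE.mollifierScale ε φ) e s = 0) ∧
      (∃ R : ℝ, 0 ≤ R ∧ (∀ s, R ^ 2 ≤ s → sqProfile (FluidPDE.mollifierScale ε φ) e s = 0) ∧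
        ∀ ξ : EuclideanSpace ℝ d, R ≤ ‖ξ‖ → FluidPDE.mollifierScale ε φ ξ = 0) ∧
      ∀ y : EuclideanSpace ℝ d, FluidPDE.mollifierScale ε φ y = sqProfile (FluidPDE.mollifierScale ε φ) e (‖y‖ ^ 2) := by
  have hk := hφ.mollifierScale hε.ne'
  have hk0 : ∀ ξ : EuclideanSpace ℝ d, ‖ξ‖ < ε * r₀ → FluidPDE.mollifierScale ε φ ξ = 0 :=
    fun ξ hξ => mollifierScale_eq_zero_of_norm_lt h0 hε hξ
  obtain ⟨R, hR0, hR⟩ := hk.exists_eq_zero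
  refine ⟨contDiff_sqProfile hk.smooth hk0 he (by positivity), fun s hs => sqProfile_eq_zero_of_lt hk0 he (by positivity) hs,
    ⟨R, hR0, fun s hs => sqProfile_eq_zero_of_le hR he hR0 hs, hR⟩, fun y => (sqProfile_norm_sq hk.radial he y).symm⟩

/-- **Eyink's transverse integrand is the cubic contraction of `∇m_T`**: for a radial bump `φ`
vanishing near the origin, `ε > 0`, a velocity slice `w`, a base point `x` and every separation
`ξ`, with `G` the square profile of `φ^ε` and `δ = δw(x;ξ)`,
`∑ᵢⱼₗ ∂ₗ m_T^{ij}(ξ) δᵢδⱼδₗ = ∇φ^ε(ξ)·δ |δ_T|² − (2/|ξ|)φ^ε(ξ) δ_L|δ_T|²`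
(Eyink 2003, (id-T), first equality, with `Torus.eyinkTransverseIntegrand`). [cite: Eyink2003, §2 (id-T)] -/
theorem eyinkTransverseIntegrand_eq_sum_fderiv (hφ : IsRadialBump φ) (hr₀ : 0 < r₀)
    (h0 : ∀ ξ : EuclideanSpace ℝ d, ‖ξ‖ < r₀ → φ ξ = 0) (hε : 0 < ε) {e : EuclideanSpace ℝ d} (he : ‖e‖ = 1)
    (w : UnitAddTorus d → EuclideanSpace ℝ d) (x : UnitAddTorus d) (ξ : EuclideanSpace ℝ d) :
    eyinkTransverseIntegrand φ ε w x ξ =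
      ∑ i, ∑ j, ∑ l, fderiv ℝ (eyinkMatKernelTE (sqProfile (FluidPDE.mollifierScale ε φ) e) i j) ξ
        (EuclideanSpace.single l 1) * (increment w ξ x i * increment w ξ x j * increment w ξ x l) := by
  obtain ⟨hG, hGa, ⟨R, -, hGR, -⟩, hk⟩ := sqProfile_mollifierScale_facts hφ hr₀ h0 hε he
  rw [sum_fderiv_eyinkMatKernelTE_mul hG (by positivity) hGa hk, eyinkTransverseIntegrand]
  by_cases hξ : ξ = 0
  · subst hξ
    simp
  · rw [norm_sq_increment_eq hξ, longitudinalIncrement_apply]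
    ring

/-- **Eyink's longitudinal integrand is the cubic contraction of `∇m_L`** (Eyink 2003, (id-L),
first equality, with `Torus.eyinkLongitudinalIntegrand`). [cite: Eyink2003, §2 (id-L)] -/
theorem eyinkLongitudinalIntegrand_eq_sum_fderiv (hφ : IsRadialBump φ) (hr₀ : 0 < r₀)
    (h0 : ∀ ξ : EuclideanSpace ℝ d, ‖ξ‖ < r₀ → φ ξ = 0) (hε : 0 < ε) {e : EuclideanSpace ℝ d} (he : ‖e‖ = 1)
    (w : UnitAddTorus d → EuclideanSpace ℝ d) (x : UnitAddTorus d) (ξ : EuclideanSpace ℝ d) :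
    eyinkLongitudinalIntegrand φ ε w x ξ =
      ∑ i, ∑ j, ∑ l, fderiv ℝ (eyinkMatKernelLE (sqProfile (FluidPDE.mollifierScale ε φ) e) i j) ξ
        (EuclideanSpace.single l 1) * (increment w ξ x i * increment w ξ x j * increment w ξ x l) := by
  obtain ⟨hG, hGa, ⟨R, -, hGR, -⟩, hk⟩ := sqProfile_mollifierScale_facts hφ hr₀ h0 hε he
  rw [sum_fderiv_eyinkMatKernelLE_mul hG (by positivity) hGa hk, eyinkLongitudinalIntegrand]
  by_cases hξ : ξ = 0
  · subst hξ
    simp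
  · rw [norm_sq_increment_eq hξ, longitudinalIncrement_apply]
    ring

end Bump

end Literature.Analysis.FluidPDE.Torus
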